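import Literature.NumberTheory.EllipticCurves.ZpExtensionEisensteinTwistDual
import Literature.NumberTheory.EllipticCurves.ZpExtensionScalarTwistFiniteProofs
import HarnessLib

/-!
# Perfectness of the duality `(M₂ ⊗ A_{m,k})(ψ⁻¹) → ((M₁ ⊗ A_{m,k})(ψ))^∨(1)`: the tail-form dual family of
# `A_{m,k}`, coordinates in `M ⊗ A_{m,k}`, and bijectivity of `eisensteinTwistDualMap` for a perfect `e`

Topic `NumberTheory/EllipticCurves` (sequel to `ZpExtensionEisensteinTwistDual`, `IwasawaAlgebraEisensteinQuotientDuality`,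
`ZpExtensionScalarTwistFiniteProofs`; the `[T^i]`-coordinates of `IwasawaAlgebraEisensteinFiniteQuotientSpanProofs` are
re-derived here from the `ℤ_p`-coordinates of `IwasawaAlgebraEisensteinQuotientDuality`, so that file is not imported). Definitions with bodies (`EisensteinCoeff.ofSpec`,
`EisensteinCoeff.dualFamily`) and theorems; no named fact, no instance, no notation, no `sorry`.

With `λ_k = EisensteinCoeff.tailFormZMod` (the tail form of `A_{m,k} = Λ/(T^m + p, p^k)` with values in `ℤ/p^k`,
PERFECT by `tailPairingZMod_bijective`) the coefficient pairing `B(c₁ ⊗ a₁, c₂ ⊗ a₂) = λ_k(c₁c₂) · e(a₁, a₂)` of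
`ZpExtensionEisensteinTwistDual` is perfect as soon as `e : M₁ × M₂ → μ_{p^k}` is: its dual map
`y ↦ B(·, y)`, `(M₂ ⊗ A_{m,k})(ψ_{κ₂}) → Hom(M₁ ⊗ A_{m,k}, μ_{p^k})` (the tree's `eisensteinTwistDualMap`), is

* injective when `e` is right-non-degenerate (`eisensteinTwistDualMap_injective`), and
* surjective when every character `M₁ → μ_{p^k}` is `e(·, w)` (`eisensteinTwistDualMap_surjective`),

hence bijective for a perfect `e` (`eisensteinTwistDualMap_bijective`) — e.g. the Weil pairing on `E[p^k]`: the
finite levels `T_𝔮/p^k T_𝔮 = E[p^k] ⊗ A_{m,k}(ψ)` of Howard's `T_𝔮` are Cartier-SELF-DUAL up to `ψ ↦ ψ⁻¹` (and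
`t ↦ t^τ`), which is the module half of hypothesis H.4 / Lemma 2.1.1 of Howard 2004 at `𝔮 = (T^m + p)`.

The proof is by coordinates: §1 the quotient map `S_m → A_{m,k}` and the **dual family**
`dualFamily i = [πᵢ^*]` (image of the tail-form dual basis of `S_m`, tree `tailDualBasis (specPowerBasis p hm)`), with
`λ_k([πᵢ^*] · [T^j]) = δ_{ij}` (`tailFormZMod_dualFamily_mul_mk_X_pow`) and `ℕ`-generation of `A_{m,k}` by it
(`exists_eq_sum_nsmul_dualFamily`); §2 coordinates `x = ∑ⱼ [πⱼ^*] ⊗ uⱼ` in `M ⊗ A_{m,k}`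
(`exists_eq_sum_tmul_dualFamily`, `exists_eq_sum_tmul_mk_X_pow_of_padicInt`); §3 the
evaluation formulas `B([πⱼ^*] ⊗ a, ∑ᵢ [T^i] ⊗ wᵢ) = e(a, wⱼ)` and the (in/sur/bi)jectivity theorems.

References: [Howard2004HeegnerKolyvagin] B. Howard, Compositio Math. 140 (2004), §1.3 (H.4), Lemma 2.1.1, §2.1 (the map
`𝒟_𝔭 → ℚ_p/ℤ_p`), §2.2 (proof of Thm. 2.2.10, `𝔮 = T^m + p`); [MazurRubin2004] §1.3, §5.3; [Washington1997] §13.2;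
[DeSmitRubinSchoof1997] Prop. 2.1 / Cor. 2.2 (dual basis of a monogenic algebra).
-/

noncomputable section

open scoped TensorProduct ContRepresentation
open Field

universe u

namespace Literature.NumberTheory.EllipticCurves

open Literature.NumberTheory.GaloisRepresentations Literature.RingTheory.CompleteIntersection

namespace IwasawaAlgebra

variable (p : ℕ) [hp : Fact p.Prime]

/-! ## §1 The quotient map `S_m → A_{m,k}` and the dual family `[πᵢ^*]` -/

/-- **`S_m = Λ/(T^m + p) ↠ A_{m,k} = Λ/(T^m + p, p^k)`**, the reduction modulo `p^k` (Mathlib `Ideal.Quotient.factor`).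
[cite: Howard2004HeegnerKolyvagin, §2.2 (T_𝔮 ↠ T_𝔮/p^k T_𝔮)] -/
def EisensteinCoeff.ofSpec (m k : ℕ) :
    (IwasawaAlgebra p ⧸ Ideal.span {(PowerSeries.X ^ m + PowerSeries.C (p : ℤ_[p]) : IwasawaAlgebra p)}) →+*
      EisensteinCoeff p m k :=
  Ideal.Quotient.factor le_sup_left

/-- Unfolding: `ofSpec [x]_{S_m} = [x]_{A_{m,k}}`. [cite: Howard2004HeegnerKolyvagin, §2.2] -/
@[simp]
theorem EisensteinCoeff.ofSpec_mk (m k : ℕ) (x : IwasawaAlgebra p) :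
    EisensteinCoeff.ofSpec p m k (Ideal.Quotient.mk _ x) = Ideal.Quotient.mk _ x := rfl

/-- `ofSpec` is `ℤ_p`-linear. [cite: Howard2004HeegnerKolyvagin, §2.2] -/
theorem EisensteinCoeff.ofSpec_smul (m k : ℕ) (z : ℤ_[p])
    (s : IwasawaAlgebra p ⧸ Ideal.span {(PowerSeries.X ^ m + PowerSeries.C (p : ℤ_[p]) : IwasawaAlgebra p)}) :
    EisensteinCoeff.ofSpec p m k (z • s) = z • EisensteinCoeff.ofSpec p m k s := by
  obtain ⟨x, rfl⟩ := Ideal.Quotient.mk_surjective s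
  rfl

/-- `λ_k(ofSpec s) = λ_S(s) mod p^k`. [cite: Howard2004HeegnerKolyvagin, §2.1 and §2.2] -/
theorem EisensteinCoeff.tailFormZMod_ofSpec {m : ℕ} (hm : 1 ≤ m) (k : ℕ)
    (s : IwasawaAlgebra p ⧸ Ideal.span {(PowerSeries.X ^ m + PowerSeries.C (p : ℤ_[p]) : IwasawaAlgebra p)}) :
    EisensteinCoeff.tailFormZMod p hm k (EisensteinCoeff.ofSpec p m k s) =
      PadicInt.toZModPow k (tailForm (specPowerBasis p hm) s) := by
  obtain ⟨x, rfl⟩ := Ideal.Quotient.mk_surjective s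
  exact EisensteinCoeff.tailFormZMod_mk p hm k x

/-- **The dual family `[πᵢ^*] ∈ A_{m,k}`, `i < m`**: the image of the tail-form dual basis `(πᵢ^*)` of `S_m`
(`tailDualBasis (specPowerBasis p hm)`, `λ_S(πᵢ^* π^j) = δ_{ij}`). [cite: DeSmitRubinSchoof1997, Cor. 2.2 (case n = 1)]
[cite: Howard2004HeegnerKolyvagin, §2.1 and §2.2] -/
def EisensteinCoeff.dualFamily {m : ℕ} (hm : 1 ≤ m) (k : ℕ) (i : Fin m) : EisensteinCoeff p m k :=
  EisensteinCoeff.ofSpec p m k (tailDualBasis (specPowerBasis p hm) (Fin.cast (specPowerBasis_dim p hm).symm i))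

/-- **`λ_k([πᵢ^*] · [T^j]) = δ_{ij}` in `ℤ/p^k`.** [cite: DeSmitRubinSchoof1997, Cor. 2.2 (case n = 1)] [cite: Howard2004HeegnerKolyvagin, §2.1 and §2.2] -/
theorem EisensteinCoeff.tailFormZMod_dualFamily_mul_mk_X_pow {m : ℕ} (hm : 1 ≤ m) (k : ℕ) (i j : Fin m) :
    EisensteinCoeff.tailFormZMod p hm k (EisensteinCoeff.dualFamily p hm k i *
      Ideal.Quotient.mk _ ((PowerSeries.X : IwasawaAlgebra p) ^ (j : ℕ))) = if j = i then 1 else 0 := by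
  have hgen : (Ideal.Quotient.mk _ ((PowerSeries.X : IwasawaAlgebra p) ^ (j : ℕ)) : EisensteinCoeff p m k) =
      EisensteinCoeff.ofSpec p m k ((specPowerBasis p hm).gen ^ ((Fin.cast (specPowerBasis_dim p hm).symm j : Fin _) : ℕ)) := by
    rw [specPowerBasis_gen, ← map_pow, Fin.val_cast, EisensteinCoeff.ofSpec_mk]
  rw [hgen, EisensteinCoeff.dualFamily, ← map_mul, EisensteinCoeff.tailFormZMod_ofSpec,
    tailForm_tailDualBasis_mul_pow]
  by_cases hij : j = i
  · subst hij
    rw [if_pos rfl, if_pos rfl, map_one]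
  · rw [if_neg (fun h => hij (Fin.cast_injective _ h)), if_neg hij, map_zero]

/-- `c • a = appr_k(c) • a` on `A_{m,k}` for `c ∈ ℤ_p` (`p^k A_{m,k} = 0`). [cite: Washington1997, §13.2] -/
theorem EisensteinCoeff.padicInt_smul_eq_appr_nsmul {m : ℕ} (k : ℕ) (c : ℤ_[p]) (a : EisensteinCoeff p m k) :
    c • a = (c.appr k) • a := by
  obtain ⟨d, hd⟩ := Ideal.mem_span_singleton'.mp (PadicInt.appr_spec k c)
  have hc : c = ((c.appr k : ℕ) : ℤ_[p]) + d * (p : ℤ_[p]) ^ k := by rw [hd]; ring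
  conv_lhs => rw [hc]
  rw [add_smul, mul_smul, EisensteinCoeff.padicInt_pow_smul_eq_zero p k a, smul_zero, add_zero, Nat.cast_smul_eq_nsmul]

/-- **Every element of `A_{m,k}` is an `ℕ`-combination of the dual family** (`S_m` is the `ℤ_p`-span of the dual
basis; push through `S_m ↠ A_{m,k}` and approximate the `ℤ_p`-coefficients modulo `p^k`). [cite: Washington1997, §13.2]
[cite: DeSmitRubinSchoof1997, Cor. 2.2 (case n = 1)] -/
theorem EisensteinCoeff.exists_eq_sum_nsmul_dualFamily {m : ℕ} (hm : 1 ≤ m) (k : ℕ) (a : EisensteinCoeff p m k) :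
    ∃ nn : Fin m → ℕ, a = ∑ i : Fin m, nn i • EisensteinCoeff.dualFamily p hm k i := by
  obtain ⟨x, rfl⟩ := Ideal.Quotient.mk_surjective a
  set s := (Ideal.Quotient.mk (Ideal.span {(PowerSeries.X ^ m + PowerSeries.C (p : ℤ_[p]) : IwasawaAlgebra p)}) x)
    with hs
  have hdim : (specPowerBasis p hm).dim = m := specPowerBasis_dim p hm
  let c : Fin m → ℤ_[p] := fun i => (tailDualBasis (specPowerBasis p hm)).repr s (Fin.cast hdim.symm i)
  refine ⟨fun i => (c i).appr k, ?_⟩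
  have hS : s = ∑ i : Fin m, c i • tailDualBasis (specPowerBasis p hm) (Fin.cast hdim.symm i) := by
    have h := ((tailDualBasis (specPowerBasis p hm)).sum_repr s).symm
    rw [← (Fin.castOrderIso hdim.symm).toEquiv.sum_comp] at h
    exact h
  have hA : (Ideal.Quotient.mk _ x : EisensteinCoeff p m k) = EisensteinCoeff.ofSpec p m k s := rfl
  rw [hA, hS, map_sum]
  refine Finset.sum_congr rfl fun i _ => ?_
  rw [EisensteinCoeff.ofSpec_smul, EisensteinCoeff.padicInt_smul_eq_appr_nsmul]
  rfl

/-! ## §2 Coordinates in `M ⊗ A_{m,k}` with respect to the dual family -/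

/-- `(n • c) ⊗ a = c ⊗ (n • a)` for `n : ℕ` (from the tree's `Twisted.tmul_nsmul` and additivity in `c`; the tree's
`Twisted.nsmul_tmul` of `IwasawaAlgebraEisensteinFiniteQuotientSpanProofs` is the same statement).
[cite: Howard2004HeegnerKolyvagin, §2.2 (T_𝔮 = 𝐓 ⊗_Λ S_𝔮)] -/
theorem EisensteinCoeff.Twisted.nsmul_tmul' {m k : ℕ} {M : Type u} [AddCommGroup M] (n : ℕ) (c : EisensteinCoeff p m k)
    (a : M) : (EisensteinCoeff.Twisted.tmul (n • c) a : EisensteinCoeff.Twisted p m k M) = EisensteinCoeff.Twisted.tmul c (n • a) := by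
  rw [EisensteinCoeff.Twisted.tmul_nsmul]
  exact map_nsmul (AddMonoidHom.mk' (fun c : EisensteinCoeff p m k =>
    (EisensteinCoeff.Twisted.tmul c a : EisensteinCoeff.Twisted p m k M)) (fun c c' => EisensteinCoeff.Twisted.add_tmul c c' a)) n c

/-- Every element of `A_{m,k}` is an `ℕ`-combination of the classes `[T^i]`, `i < m` (from the `ℤ_p`-coordinates
`exists_eq_sum_padicInt_smul_mk_X_pow` and `c • a = appr_k(c) • a`). [cite: Washington1997, §7.1 (Prop. 7.2) and §13.2] -/
theorem EisensteinCoeff.exists_eq_sum_nsmul_mk_X_pow_of_padicInt {m : ℕ} (hm : 1 ≤ m) (k : ℕ) (a : EisensteinCoeff p m k) :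
    ∃ nn : Fin m → ℕ, a = ∑ i : Fin m, nn i • (Ideal.Quotient.mk _ ((PowerSeries.X : IwasawaAlgebra p) ^ (i : ℕ)) :
      EisensteinCoeff p m k) := by
  obtain ⟨c, rfl⟩ := EisensteinCoeff.exists_eq_sum_padicInt_smul_mk_X_pow p hm k a
  exact ⟨fun i => (c i).appr k, Finset.sum_congr rfl fun i _ => EisensteinCoeff.padicInt_smul_eq_appr_nsmul p k (c i) _⟩

/-- **`[T^i]`-coordinates**: every element of `M ⊗ A_{m,k}` is `∑ᵢ [T^i] ⊗ wᵢ` (same statement as the tree's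
`exists_eq_sum_tmul_mk_X_pow`, derived here from the `ℤ_p`-coordinates). [cite: Howard2004HeegnerKolyvagin, §2.2 (T_𝔮 = 𝐓 ⊗_Λ S_𝔮)]
[cite: Washington1997, §13.2] -/
theorem EisensteinCoeff.exists_eq_sum_tmul_mk_X_pow_of_padicInt {m : ℕ} (hm : 1 ≤ m) {k : ℕ} {M : Type u} [AddCommGroup M]
    (x : EisensteinCoeff.Twisted p m k M) :
    ∃ w : Fin m → M, x = ∑ i : Fin m, EisensteinCoeff.Twisted.tmul
      (Ideal.Quotient.mk _ ((PowerSeries.X : IwasawaAlgebra p) ^ (i : ℕ)) : EisensteinCoeff p m k) (w i) := by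
  induction x using EisensteinCoeff.Twisted.induction_on with
  | zero => exact ⟨0, by simp only [Pi.zero_apply, EisensteinCoeff.Twisted.tmul_zero, Finset.sum_const_zero]⟩
  | tmul c b =>
    obtain ⟨nn, rfl⟩ := EisensteinCoeff.exists_eq_sum_nsmul_mk_X_pow_of_padicInt p hm k c
    refine ⟨fun i => nn i • b, ?_⟩
    have hf := map_sum (AddMonoidHom.mk' (fun c : EisensteinCoeff p m k =>
        (EisensteinCoeff.Twisted.tmul c b : EisensteinCoeff.Twisted p m k M))
      (fun c c' => EisensteinCoeff.Twisted.add_tmul c c' b))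
      (fun i : Fin m => nn i • (Ideal.Quotient.mk _ ((PowerSeries.X : IwasawaAlgebra p) ^ (i : ℕ)) : EisensteinCoeff p m k))
      Finset.univ
    refine hf.trans (Finset.sum_congr rfl fun i _ => ?_)
    exact EisensteinCoeff.Twisted.nsmul_tmul' p (nn i) _ b
  | add x y hx hy =>
    obtain ⟨a, rfl⟩ := hx
    obtain ⟨b, rfl⟩ := hy
    refine ⟨a + b, ?_⟩
    rw [← Finset.sum_add_distrib]
    exact Finset.sum_congr rfl fun i _ => (EisensteinCoeff.Twisted.tmul_add _ (a i) (b i)).symm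

/-- **Every element of `M ⊗ A_{m,k}` is `∑ⱼ [πⱼ^*] ⊗ uⱼ`** (companion of the tree's `[T^i]`-coordinates
`exists_eq_sum_tmul_mk_X_pow`). [cite: Howard2004HeegnerKolyvagin, §2.2 (T_𝔮 = 𝐓 ⊗_Λ S_𝔮)] [cite: Washington1997, §13.2] -/
theorem EisensteinCoeff.exists_eq_sum_tmul_dualFamily {m : ℕ} (hm : 1 ≤ m) {k : ℕ} {M : Type u} [AddCommGroup M]
    (x : EisensteinCoeff.Twisted p m k M) :
    ∃ u : Fin m → M, x = ∑ j : Fin m, EisensteinCoeff.Twisted.tmul (EisensteinCoeff.dualFamily p hm k j) (u j) := by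
  induction x using EisensteinCoeff.Twisted.induction_on with
  | zero => exact ⟨0, by simp only [Pi.zero_apply, EisensteinCoeff.Twisted.tmul_zero, Finset.sum_const_zero]⟩
  | tmul c b =>
    obtain ⟨nn, rfl⟩ := EisensteinCoeff.exists_eq_sum_nsmul_dualFamily p hm k c
    refine ⟨fun i => nn i • b, ?_⟩
    have hf := map_sum (AddMonoidHom.mk' (fun c : EisensteinCoeff p m k =>
        (EisensteinCoeff.Twisted.tmul c b : EisensteinCoeff.Twisted p m k M))
      (fun c c' => EisensteinCoeff.Twisted.add_tmul c c' b))
      (fun i : Fin m => nn i • EisensteinCoeff.dualFamily p hm k i) Finset.univ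
    refine hf.trans (Finset.sum_congr rfl fun i _ => ?_)
    exact EisensteinCoeff.Twisted.nsmul_tmul' p (nn i) _ b
  | add x y hx hy =>
    obtain ⟨a, rfl⟩ := hx
    obtain ⟨b, rfl⟩ := hy
    refine ⟨a + b, ?_⟩
    rw [← Finset.sum_add_distrib]
    exact Finset.sum_congr rfl fun i _ => (EisensteinCoeff.Twisted.tmul_add _ (a i) (b i)).symm

end IwasawaAlgebra

/-! ## §3 Perfectness of the dual map -/

namespace ZpExtension

open IwasawaAlgebra

variable {K : Type u} [Field K] {p : ℕ} [hp : Fact p.Prime] {m : ℕ} (hm : 1 ≤ m) (k : ℕ)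
  {M₁ M₂ : Type u} [AddCommGroup M₁] [TopologicalSpace M₁] [DiscreteTopology M₁]
  [AddCommGroup M₂] [TopologicalSpace M₂] [DiscreteTopology M₂]
  {P : Type u} [AddCommGroup P]
  (e : M₁ →+ M₂ →+ P) (hP : ∀ q : P, (p ^ k) • q = 0)

omit [TopologicalSpace M₁] [DiscreteTopology M₁] [TopologicalSpace M₂] [DiscreteTopology M₂] in
/-- **Evaluation formula**: `B([πⱼ^*] ⊗ a, ∑ᵢ [T^i] ⊗ wᵢ) = e(a, wⱼ)` for `λ = λ_k` (`δ_{ij}` kills the other terms,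
and `1 ∈ ℤ/p^k` acts trivially). [cite: DeSmitRubinSchoof1997, Cor. 2.2 (case n = 1)] [cite: Howard2004HeegnerKolyvagin, Lemma 2.1.1] -/
theorem coeffPairing_dualFamily_tmul_sum (j : Fin m) (a : M₁) (w : Fin m → M₂) :
    coeffPairing (EisensteinCoeff.tailFormZMod p hm k).toAddMonoidHom e hP
      (EisensteinCoeff.Twisted.tmul (EisensteinCoeff.dualFamily p hm k j) a)
      (∑ i : Fin m, EisensteinCoeff.Twisted.tmul
        (Ideal.Quotient.mk _ ((PowerSeries.X : IwasawaAlgebra p) ^ (i : ℕ)) : EisensteinCoeff p m k) (w i)) =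
      e a (w j) := by
  rw [map_sum, Finset.sum_eq_single j]
  · rw [coeffPairing_twisted_tmul_tmul, LinearMap.toAddMonoidHom_coe,
      EisensteinCoeff.tailFormZMod_dualFamily_mul_mk_X_pow, if_pos rfl]
    exact ZMod.nsmulHom_one_apply hP (e a (w j))
  · intro i _ hij
    rw [coeffPairing_twisted_tmul_tmul, LinearMap.toAddMonoidHom_coe,
      EisensteinCoeff.tailFormZMod_dualFamily_mul_mk_X_pow, if_neg hij, ZMod.val_zero, zero_smul]
  · intro h; exact absurd (Finset.mem_univ j) h

omit [TopologicalSpace M₁] [DiscreteTopology M₁] [TopologicalSpace M₂] [DiscreteTopology M₂] in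
/-- **Evaluation formula, summed**: `B(∑ⱼ [πⱼ^*] ⊗ uⱼ, ∑ᵢ [T^i] ⊗ wᵢ) = ∑ⱼ e(uⱼ, wⱼ)`.
[cite: DeSmitRubinSchoof1997, Cor. 2.2 (case n = 1)] [cite: Howard2004HeegnerKolyvagin, Lemma 2.1.1] -/
theorem coeffPairing_sum_tmul_sum (u : Fin m → M₁) (w : Fin m → M₂) :
    coeffPairing (EisensteinCoeff.tailFormZMod p hm k).toAddMonoidHom e hP
      (∑ j : Fin m, EisensteinCoeff.Twisted.tmul (EisensteinCoeff.dualFamily p hm k j) (u j))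
      (∑ i : Fin m, EisensteinCoeff.Twisted.tmul
        (Ideal.Quotient.mk _ ((PowerSeries.X : IwasawaAlgebra p) ^ (i : ℕ)) : EisensteinCoeff p m k) (w i)) =
      ∑ j : Fin m, e (u j) (w j) := by
  rw [map_sum (coeffPairing (EisensteinCoeff.tailFormZMod p hm k).toAddMonoidHom e hP)
    (fun j => EisensteinCoeff.Twisted.tmul (EisensteinCoeff.dualFamily p hm k j) (u j)) Finset.univ,
    AddMonoidHom.finsetSum_apply]
  exact Finset.sum_congr rfl fun j _ => coeffPairing_dualFamily_tmul_sum hm k e hP j (u j) w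

omit [TopologicalSpace M₁] [DiscreteTopology M₁] [TopologicalSpace M₂] [DiscreteTopology M₂] in
/-- **Left non-degeneracy of `B_{λ_k, e}`**: if `e` is right-non-degenerate then `B(x, y) = 0` for all `x` forces
`y = 0`. [cite: Howard2004HeegnerKolyvagin, §1.3 (H.4, «perfect») and Lemma 2.1.1] -/
theorem coeffPairing_eq_zero_of_forall (he₂ : ∀ w : M₂, (∀ a : M₁, e a w = 0) → w = 0)
    {y : EisensteinCoeff.Twisted p m k M₂}
    (hy : ∀ x, coeffPairing (EisensteinCoeff.tailFormZMod p hm k).toAddMonoidHom e hP x y = 0) : y = 0 := by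
  obtain ⟨w, rfl⟩ := EisensteinCoeff.exists_eq_sum_tmul_mk_X_pow_of_padicInt p hm y
  have hw : ∀ j, w j = 0 := fun j => he₂ _ fun a => by
    rw [← coeffPairing_dualFamily_tmul_sum hm k e hP j a w]
    exact hy _
  simp only [hw, EisensteinCoeff.Twisted.tmul_zero, Finset.sum_const_zero]

variable (ρ₁ : DiscreteGaloisModule K M₁) (ρ₂ : DiscreteGaloisModule K M₂)
  (eμ : M₁ →+ M₂ →+ DiscreteGaloisModule.MuCarrier K (p ^ k))
  (heμ : ∀ (g : absoluteGaloisGroup K) (a : M₁) (b : M₂),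
    eμ (ρ₁ g a) (ρ₂ g b) = DiscreteGaloisModule.mu K (p ^ k) g (eμ a b))
  (κ₁ κ₂ : ZpExtension K p)
  (hκ : ∀ g : absoluteGaloisGroup K,
    p ^ eisensteinLevel (p := p) hm k ∣ κ₁.twistExponent (eisensteinLevel (p := p) hm k) g +
      κ₂.twistExponent (eisensteinLevel (p := p) hm k) g)
  [Finite (EisensteinCoeff.Twisted p m k M₁)]

/-- **Injectivity of the dual map** `(M₂ ⊗ A_{m,k})(ψ_{κ₂}) → Hom(M₁ ⊗ A_{m,k}, μ_{p^k})` for `λ = λ_k` and a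
right-non-degenerate `e`. [cite: Howard2004HeegnerKolyvagin, §1.3 (H.4) and Lemma 2.1.1] [cite: MazurRubin2004, §5.3] -/
theorem eisensteinTwistDualMap_injective (he₂ : ∀ w : M₂, (∀ a : M₁, eμ a w = 0) → w = 0) :
    Function.Injective (eisensteinTwistDualMap hm k (p ^ k) (EisensteinCoeff.tailFormZMod p hm k).toAddMonoidHom
      ρ₁ ρ₂ eμ heμ κ₁ κ₂ hκ) := by
  intro y y' h
  rw [← sub_eq_zero]
  refine coeffPairing_eq_zero_of_forall hm k eμ (nsmul_muCarrier_eq_zero (p ^ k)) he₂ fun x => ?_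
  have hx := DFunLike.congr_fun h x
  rw [eisensteinTwistDualMap_apply_apply, eisensteinTwistDualMap_apply_apply] at hx
  rw [map_sub, hx, sub_self]

/-- **Surjectivity of the dual map** for `λ = λ_k` when every character `M₁ → μ_{p^k}` is `e(·, w)`: given
`F ∈ Hom(M₁ ⊗ A_{m,k}, μ)`, `y = ∑ᵢ [T^i] ⊗ wᵢ` with `e(·, wᵢ) = F([πᵢ^*] ⊗ ·)` works.
[cite: Howard2004HeegnerKolyvagin, §1.3 (H.4) and Lemma 2.1.1] [cite: MazurRubin2004, §5.3] -/
theorem eisensteinTwistDualMap_surjective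
    (he₁ : ∀ φ : M₁ →+ DiscreteGaloisModule.MuCarrier K (p ^ k), ∃ w : M₂, ∀ a : M₁, eμ a w = φ a) :
    Function.Surjective (eisensteinTwistDualMap hm k (p ^ k) (EisensteinCoeff.tailFormZMod p hm k).toAddMonoidHom
      ρ₁ ρ₂ eμ heμ κ₁ κ₂ hκ) := by
  intro F
  -- characters `a ↦ F([πᵢ^*] ⊗ a)`
  have hφ : ∀ i : Fin m, ∃ w : M₂, ∀ a : M₁, eμ a w =
      F (EisensteinCoeff.Twisted.tmul (EisensteinCoeff.dualFamily p hm k i) a) := fun i =>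
    he₁ ((F : EisensteinCoeff.Twisted p m k M₁ →+ DiscreteGaloisModule.MuCarrier K (p ^ k)).comp
      (AddMonoidHom.mk' (fun a => EisensteinCoeff.Twisted.tmul (EisensteinCoeff.dualFamily p hm k i) a)
        fun a b => EisensteinCoeff.Twisted.tmul_add _ a b))
  choose w hw using hφ
  refine ⟨∑ i : Fin m, EisensteinCoeff.Twisted.tmul
    (Ideal.Quotient.mk _ ((PowerSeries.X : IwasawaAlgebra p) ^ (i : ℕ)) : EisensteinCoeff p m k) (w i), ?_⟩
  refine DiscreteGaloisModule.TateDual.ext fun x => ?_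
  obtain ⟨u, rfl⟩ := EisensteinCoeff.exists_eq_sum_tmul_dualFamily p hm x
  rw [eisensteinTwistDualMap_apply_apply, coeffPairing_sum_tmul_sum, map_sum]
  exact Finset.sum_congr rfl fun j _ => hw j (u j)

/-- **Perfectness**: for `λ = λ_k` and a perfect `e : M₁ × M₂ → μ_{p^k}` (right-non-degenerate and exhausting the
characters of `M₁`; e.g. the Weil pairing on `E[p^k] × E[p^k]`), the equivariant dual map
`(M₂ ⊗ A_{m,k})(ψ_{κ₂}) → ((M₁ ⊗ A_{m,k})(ψ_{κ₁}))^∨(1)` is a bijection — Howard's H.4 «perfect … T × Tw(T) → R(1)»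
for the finite levels of `T_𝔮`, `𝔮 = (T^m + p)`, in the tree's `tateDual` currency.
[cite: Howard2004HeegnerKolyvagin, §1.3 (H.4) and Lemma 2.1.1] [cite: MazurRubin2004, §5.3] -/
theorem eisensteinTwistDualMap_bijective (he₂ : ∀ w : M₂, (∀ a : M₁, eμ a w = 0) → w = 0)
    (he₁ : ∀ φ : M₁ →+ DiscreteGaloisModule.MuCarrier K (p ^ k), ∃ w : M₂, ∀ a : M₁, eμ a w = φ a) :
    Function.Bijective (eisensteinTwistDualMap hm k (p ^ k) (EisensteinCoeff.tailFormZMod p hm k).toAddMonoidHom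
      ρ₁ ρ₂ eμ heμ κ₁ κ₂ hκ) :=
  ⟨eisensteinTwistDualMap_injective hm k ρ₁ ρ₂ eμ heμ κ₁ κ₂ hκ he₂,
    eisensteinTwistDualMap_surjective hm k ρ₁ ρ₂ eμ heμ κ₁ κ₂ hκ he₁⟩

/-- The same for the named pair `(κ, κ⁻¹)`: `(M₂ ⊗ A_{m,k})(ψ⁻¹) ⥲ ((M₁ ⊗ A_{m,k})(ψ))^∨(1)`.
[cite: Howard2004HeegnerKolyvagin, §1.3 (H.4) and Lemma 2.1.1] [cite: MazurRubin2004, §5.3] -/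
theorem eisensteinTwistDualMap_inv_bijective (κ : ZpExtension K p) (he₂ : ∀ w : M₂, (∀ a : M₁, eμ a w = 0) → w = 0)
    (he₁ : ∀ φ : M₁ →+ DiscreteGaloisModule.MuCarrier K (p ^ k), ∃ w : M₂, ∀ a : M₁, eμ a w = φ a) :
    Function.Bijective (eisensteinTwistDualMap_inv hm k (p ^ k) (EisensteinCoeff.tailFormZMod p hm k).toAddMonoidHom
      ρ₁ ρ₂ eμ heμ κ) :=
  eisensteinTwistDualMap_bijective hm k ρ₁ ρ₂ eμ heμ κ κ.invTwist _ he₂ he₁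

/-- And for `(κ⁻¹, κ)`: `(M₂ ⊗ A_{m,k})(ψ) ⥲ ((M₁ ⊗ A_{m,k})(ψ⁻¹))^∨(1)` (the D1 convention, carrier = `κ.unitTwist (-1)`-twist).
[cite: Howard2004HeegnerKolyvagin, §1.3 (H.4) and Lemma 2.1.1] [cite: MazurRubin2004, §5.3] -/
theorem eisensteinTwistDualMap_inv'_bijective (κ : ZpExtension K p) (he₂ : ∀ w : M₂, (∀ a : M₁, eμ a w = 0) → w = 0)
    (he₁ : ∀ φ : M₁ →+ DiscreteGaloisModule.MuCarrier K (p ^ k), ∃ w : M₂, ∀ a : M₁, eμ a w = φ a) :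
    Function.Bijective (eisensteinTwistDualMap_inv' hm k (p ^ k) (EisensteinCoeff.tailFormZMod p hm k).toAddMonoidHom
      ρ₁ ρ₂ eμ heμ κ) :=
  eisensteinTwistDualMap_bijective hm k ρ₁ ρ₂ eμ heμ κ.invTwist κ _ he₂ he₁

end ZpExtension

end Literature.NumberTheory.EllipticCurves
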